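import Summits.AtomisticToContinuum.Crystallization.Theorems.ChartedPlanarOrderTubeConvex

/-!
# W′ split beneath: `TubeConvexW' ⟸ TubeLipschitzW' ∧ TubeConvexityW'` — the ANALYTIC half separated from the CERT half
(decomp-a2c lens-3 g24, lens «one certified translation + split beneath»; companion of `…ChartedPlanarOrderTubeConvex`.)

The convex tube data `TubeConvexData a b w ρ` of slot 7c′ are a CONJUNCTION of two clauses of different nature, and the glue below is the
trivial ∧-split at the data level, threaded through the three binder lists (W′ of record, W, reference-centred):

* `TubeLipschitzData a b w ρ := ∃ κ ≥ 0, Summable κ ∧ Summable (|j| κ j) ∧ IsTubeLipschitz a b w ρ κ` — [ANALYTIC · TRUE-type · ATTACKABLE].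
  Attack plan (size M/L, from the landed / queued Lipschitz bricks (o) `…PairForceLipschitz`, (q) `…PlanarLatticeSums` and the straddle
  bookkeeping of `…ChartedPlanarOrderStraddleSummable`): `gapStress a b m h = Σ_{k < m ≤ l} F_layer (offset_h k l)` with
  `offset_h k l = Σ_{k < i ≤ l} h i`; if `L_s` is a Lipschitz constant of the one-site/one-layer force `F_layer` on the slab of heights
  `≈ s·(h₀ ± ρ)` (`L_s ≤ C (s (h₀ − ρ))⁻⁶` up to the in-plane lattice-sum constant), then
  `‖gapStress m h − gapStress m h'‖ ≤ Σ_{k < m ≤ l} L_{l−k} Σ_{k < i ≤ l} ‖h i − h' i‖ = Σ_j κ j ‖h (m+j) − h' (m+j)‖` with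
  `κ j := Σ_{s ≥ |j|+1} (s − |j|) L_s = O(|j|⁻⁴)`, so `Σ κ < ∞` and `Σ |j| κ j < ∞` (first moment `O(Σ |j|⁻³)`).
* `TubeConvexityData a b w ρ := ∃ λ > 0, IsTubeConvex a b w ρ λ` — [CERT · INSTRUMENTABLE, census TAG 161b: `λ_min` of the symmetrised
  finite-section Hessian of the interlayer energy in the increments, uniformly on the `ρ`-tube round the balanced registry centre].

PROVED here: `tubeConvexData_of_split`, `tubeConvexData_split_iff`; statement level `tubeConvexW'_of_split : TubeLipschitzW' Λ ρ →
TubeConvexityW' Λ ρ → TubeConvexW' Λ ρ` (slot 7c′ of record ⟸ 7c′ᴸ ∧ 7c′ᶜ), `tubeConvexW_of_split`, `tubeConvexRef_of_split`, and the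
converses (`…_lipschitz_of_…`, `…_convexity_of_…`: the split is EXACT, no strength lost).
Mathlib + the cited tree modules only; no instances, no notation; sorry-free.
-/

noncomputable section

namespace Summit.AtomisticToContinuum.Crystallization.Theorems.ChartedPlanarOrderTubeConvexSplit

open Summit.AtomisticToContinuum.Crystallization.Theorems.OverbindingBudgetElasticSplitShear (StressFree)
open Summit.AtomisticToContinuum.Crystallization.Theorems.ChartedPlanarOrderChunkFloor (E3)
open Summit.AtomisticToContinuum.Crystallization.Theorems.ChartedPlanarOrderRigidityDoor (IsNash)
open Summit.AtomisticToContinuum.Crystallization.Theorems.ChartedPlanarOrderDensityDichotomy (μS IsSep)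
open Summit.AtomisticToContinuum.Crystallization.Theorems.ChartedPlanarOrderDoorLayered (Layered)
open Summit.AtomisticToContinuum.Crystallization.Theorems.ChartedPlanarOrderProfileSlavingLJ (IsStacked gapStress incr)
open Summit.AtomisticToContinuum.Crystallization.Theorems.OverbindingBudgetPeriodicCleanOrStrained (UniformlyClean)
open Summit.AtomisticToContinuum.Crystallization.Theorems.OverbindingBudgetScaleWidening (IsCleanW)
open Summit.AtomisticToContinuum.Crystallization.Theorems.ChartedPlanarOrderTubeConvex (IsTubeLipschitz IsTubeConvex TubeConvexData
  TubeConvexW TubeConvexW' TubeConvexRef)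

/-! ## Data level -/

/-- **7c′ᴸ data · `TubeLipschitzData a b w ρ`** — summable cross-gap Lipschitz weights with finite first moment for the gap-stress map on the
`ρ`-tube round `w`. [ANALYTIC · TRUE-type · ATTACKABLE: `κ j = Σ_{s > |j|} (s − |j|) L_s = O(|j|⁻⁴)` from the layer-force Lipschitz bricks] -/
def TubeLipschitzData (a b : E3) (w : ℤ → E3) (ρ : ℝ) : Prop :=
  ∃ κ : ℤ → ℝ, (∀ j, 0 ≤ κ j) ∧ Summable κ ∧ Summable (fun j : ℤ => |(j : ℝ)| * κ j) ∧ IsTubeLipschitz a b w ρ κ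

/-- **7c′ᶜ data · `TubeConvexityData a b w ρ`** — a positive ℓ²-monotonicity constant of the WHOLE gap-stress map on finitely supported
differences of `ρ`-tube profiles. [CERT · INSTRUMENTABLE, TAG 161b] -/
def TubeConvexityData (a b : E3) (w : ℤ → E3) (ρ : ℝ) : Prop :=
  ∃ lam : ℝ, 0 < lam ∧ IsTubeConvex a b w ρ lam

/-- glue (data level): Lipschitz data ∧ convexity data ⇒ convex tube data. [this file] -/
theorem tubeConvexData_of_split {a b : E3} {w : ℤ → E3} {ρ : ℝ} (hL : TubeLipschitzData a b w ρ) (hC : TubeConvexityData a b w ρ) :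
    TubeConvexData a b w ρ := by
  obtain ⟨κ, hκ0, hκs, hκ1, hlip⟩ := hL
  obtain ⟨lam, hlam, hconv⟩ := hC
  exact ⟨lam, κ, hlam, hκ0, hκs, hκ1, hconv, hlip⟩

/-- the split is EXACT: `TubeConvexData ↔ TubeLipschitzData ∧ TubeConvexityData`. [this file] -/
theorem tubeConvexData_split_iff {a b : E3} {w : ℤ → E3} {ρ : ℝ} :
    TubeConvexData a b w ρ ↔ TubeLipschitzData a b w ρ ∧ TubeConvexityData a b w ρ := by
  constructor
  · rintro ⟨lam, κ, hlam, hκ0, hκs, hκ1, hconv, hlip⟩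
    exact ⟨⟨κ, hκ0, hκs, hκ1, hlip⟩, ⟨lam, hlam, hconv⟩⟩
  · rintro ⟨hL, hC⟩
    exact tubeConvexData_of_split hL hC

/-! ## Statement level — binder lists VERBATIM from `TubeConvexW'` / `TubeConvexW` / `TubeConvexRef` -/

/-- **7c′ᴸ · `TubeLipschitzW' Λ ρ`** — the ANALYTIC half of slot 7c′ of record. [ANALYTIC · TRUE-type · ATTACKABLE] [piece] -/
def TubeLipschitzW' (Λ ρ : ℝ) : Prop :=
  ∀ δ : ℝ, 0 < δ → ∀ (a b : E3) (w : ℤ → E3), ‖a‖ ≤ Λ → ‖b‖ ≤ Λ →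
    IsSep δ (Layered a b w) → IsCleanW (μS (Layered a b w)) → IsNash (μS (Layered a b w)) → IsStacked a b w →
    StressFree (Layered a b w) → (∀ m : ℤ, gapStress a b m (incr w) = 0) → TubeLipschitzData a b w ρ

/-- **7c′ᶜ · `TubeConvexityW' Λ ρ`** — the CERT half of slot 7c′ of record: a positive ℓ²-monotonicity constant on the `ρ`-tube round every
admissible zero-gap-stress stacked configuration.  Why it might fail: as `TubeConvexW'` (far normal softening vs adjacent normal stiffness near
the compressed edge of the clean window). [CERT · INSTRUMENTABLE, TAG 161b] [piece] -/
def TubeConvexityW' (Λ ρ : ℝ) : Prop :=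
  ∀ δ : ℝ, 0 < δ → ∀ (a b : E3) (w : ℤ → E3), ‖a‖ ≤ Λ → ‖b‖ ≤ Λ →
    IsSep δ (Layered a b w) → IsCleanW (μS (Layered a b w)) → IsNash (μS (Layered a b w)) → IsStacked a b w →
    StressFree (Layered a b w) → (∀ m : ℤ, gapStress a b m (incr w) = 0) → TubeConvexityData a b w ρ

/-- ★ glue: `TubeLipschitzW' Λ ρ → TubeConvexityW' Λ ρ → TubeConvexW' Λ ρ` (slot 7c′ ⟸ 7c′ᴸ ∧ 7c′ᶜ). [this file] -/
theorem tubeConvexW'_of_split {Λ ρ : ℝ} (hL : TubeLipschitzW' Λ ρ) (hC : TubeConvexityW' Λ ρ) : TubeConvexW' Λ ρ :=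
  fun δ hδ a b w ha hb hs hc hn hst hf hz =>
    tubeConvexData_of_split (hL δ hδ a b w ha hb hs hc hn hst hf hz) (hC δ hδ a b w ha hb hs hc hn hst hf hz)

/-- converse halves (the split loses nothing). [this file] -/
theorem tubeLipschitzW'_of_tubeConvexW' {Λ ρ : ℝ} (h : TubeConvexW' Λ ρ) : TubeLipschitzW' Λ ρ :=
  fun δ hδ a b w ha hb hs hc hn hst hf hz => (tubeConvexData_split_iff.mp (h δ hδ a b w ha hb hs hc hn hst hf hz)).1

/-- converse, convexity half. [this file] -/
theorem tubeConvexityW'_of_tubeConvexW' {Λ ρ : ℝ} (h : TubeConvexW' Λ ρ) : TubeConvexityW' Λ ρ :=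
  fun δ hδ a b w ha hb hs hc hn hst hf hz => (tubeConvexData_split_iff.mp (h δ hδ a b w ha hb hs hc hn hst hf hz)).2

/-- **`TubeLipschitzW Λ ρ`** — the Lipschitz half on `TubeConvexW`'s binder list (no stress-free / zero-stress binders). [ANALYTIC] [piece] -/
def TubeLipschitzW (Λ ρ : ℝ) : Prop :=
  ∀ δ : ℝ, 0 < δ → ∀ (a b : E3) (w : ℤ → E3), ‖a‖ ≤ Λ → ‖b‖ ≤ Λ →
    IsSep δ (Layered a b w) → IsCleanW (μS (Layered a b w)) → IsNash (μS (Layered a b w)) → IsStacked a b w →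
    TubeLipschitzData a b w ρ

/-- **`TubeConvexityW Λ ρ`** — the convexity half on `TubeConvexW`'s binder list. [CERT · INSTRUMENTABLE] [piece] -/
def TubeConvexityW (Λ ρ : ℝ) : Prop :=
  ∀ δ : ℝ, 0 < δ → ∀ (a b : E3) (w : ℤ → E3), ‖a‖ ≤ Λ → ‖b‖ ≤ Λ →
    IsSep δ (Layered a b w) → IsCleanW (μS (Layered a b w)) → IsNash (μS (Layered a b w)) → IsStacked a b w →
    TubeConvexityData a b w ρ

/-- glue: `TubeLipschitzW Λ ρ → TubeConvexityW Λ ρ → TubeConvexW Λ ρ`. [this file] -/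
theorem tubeConvexW_of_split {Λ ρ : ℝ} (hL : TubeLipschitzW Λ ρ) (hC : TubeConvexityW Λ ρ) : TubeConvexW Λ ρ :=
  fun δ hδ a b w ha hb hs hc hn hst =>
    tubeConvexData_of_split (hL δ hδ a b w ha hb hs hc hn hst) (hC δ hδ a b w ha hb hs hc hn hst)

/-- the W halves feed the W′ halves (forget the two extra binders). [this file] -/
theorem tubeLipschitzW'_of_W {Λ ρ : ℝ} (h : TubeLipschitzW Λ ρ) : TubeLipschitzW' Λ ρ :=
  fun δ hδ a b w ha hb hs hc hn hst _ _ => h δ hδ a b w ha hb hs hc hn hst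

/-- the W convexity half feeds the W′ one. [this file] -/
theorem tubeConvexityW'_of_W {Λ ρ : ℝ} (h : TubeConvexityW Λ ρ) : TubeConvexityW' Λ ρ :=
  fun δ hδ a b w ha hb hs hc hn hst _ _ => h δ hδ a b w ha hb hs hc hn hst

/-- **`TubeLipschitzRef Λ₁ ρ`** — the Lipschitz half on the reference-centred binder list of `TubeConvexRef`. [ANALYTIC] [piece] -/
def TubeLipschitzRef (Λ₁ ρ : ℝ) : Prop :=
  ∀ δ : ℝ, 0 < δ → ∀ (a b : E3) (w' : ℤ → E3), IsStacked a b w' → LinearIndependent ℝ ![a, b] → ‖a‖ ≤ Λ₁ → ‖b‖ ≤ Λ₁ →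
    IsSep δ (Layered a b w') → IsCleanW (μS (Layered a b w')) → (∀ m : ℤ, gapStress a b m (incr w') = 0) →
    UniformlyClean (Layered a b w') → TubeLipschitzData a b w' ρ

/-- **`TubeConvexityRef Λ₁ ρ`** — the convexity half on the reference-centred binder list (census objects = references). [CERT · INSTRUMENTABLE] [piece] -/
def TubeConvexityRef (Λ₁ ρ : ℝ) : Prop :=
  ∀ δ : ℝ, 0 < δ → ∀ (a b : E3) (w' : ℤ → E3), IsStacked a b w' → LinearIndependent ℝ ![a, b] → ‖a‖ ≤ Λ₁ → ‖b‖ ≤ Λ₁ →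
    IsSep δ (Layered a b w') → IsCleanW (μS (Layered a b w')) → (∀ m : ℤ, gapStress a b m (incr w') = 0) →
    UniformlyClean (Layered a b w') → TubeConvexityData a b w' ρ

/-- glue: `TubeLipschitzRef Λ₁ ρ → TubeConvexityRef Λ₁ ρ → TubeConvexRef Λ₁ ρ`. [this file] -/
theorem tubeConvexRef_of_split {Λ₁ ρ : ℝ} (hL : TubeLipschitzRef Λ₁ ρ) (hC : TubeConvexityRef Λ₁ ρ) : TubeConvexRef Λ₁ ρ :=
  fun δ hδ a b w' hst hab ha hb hs hc hz hUC =>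
    tubeConvexData_of_split (hL δ hδ a b w' hst hab ha hb hs hc hz hUC) (hC δ hδ a b w' hst hab ha hb hs hc hz hUC)

end Summit.AtomisticToContinuum.Crystallization.Theorems.ChartedPlanarOrderTubeConvexSplit

end
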